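import Literature.NumberTheory.EllipticCurves.Skinner2016.MultiplicativeMainConjecture
import Literature.NumberTheory.EllipticCurves.Greenberg1999.EulerCharacteristicSplitMultiplicativeAnyPrime
import Literature.NumberTheory.EllipticCurves.Greenberg1999.EulerCharacteristicNonsplitMultiplicativeAnyPrime
import Literature.NumberTheory.EllipticCurves.PAdicLFunctionNonsplitMultiplicativeExistenceProofs
import Literature.NumberTheory.EllipticCurves.PAdicHeightsLInvariantHoldsProofs
import Literature.NumberTheory.EllipticCurves.PAdicHeightsProofs
import Literature.NumberTheory.EllipticCurves.BSDSelmerPConverseRankZeroProofs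
import Literature.NumberTheory.EllipticCurves.BSDSelmerCMPConverseRankOneProofs
import Literature.NumberTheory.EllipticCurves.BSDRankZeroDensityProofs
import Literature.NumberTheory.EllipticCurves.MordellWeilRankZeroProofs
import Literature.NumberTheory.EllipticCurves.BSDInvariantsProofs
import Literature.NumberTheory.EllipticCurves.LeadingTermBSZOrdinaryProofs
import Literature.NumberTheory.EllipticCurves.OpenImageMazurAssemblyProofs
import Literature.NumberTheory.EllipticCurves.HeightDensityFullBSDOffS
import Literature.Barriers.BirchSwinnertonDyer.ExceptionalZero
import HarnessLib

/-!
# The rank-zero `p`-converse at a MULTIPLICATIVE prime `p ‖ N`, below Skinner's main conjecture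
# (Thm. A), Greenberg's multiplicative Euler-characteristic formula and Greenberg–Stevens — and
# Bhargava–Skinner–Zhang Thm. 5 / the binder `h5` of `bsz_rankLeOne_cRank_of_pieces` on the
# MULTIPLICATIVE half of `S₀(5) = {5 ∤ A}`

Seventh sibling *proofs* file (theorems only: no definition, no named fact, no instance; D-0014 /
D-0026) of `Literature.NumberTheory.EllipticCurves.LeadingTerm` for the rank part of BSD by naive
height, next to `LeadingTermBSZRankOneLegProofs` (good-ordinary `h9`),
`LeadingTermBSZRankOneMultiplicativeLegProofs` (multiplicative `h9`) and the good-ordinary rank-zero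
converse `BSDSelmerPConverseRankZeroProofs`. It is the MULTIPLICATIVE companion of
`entireLFunction_one_ne_zero_of_finite_selmerGroupPInfty_of_mainConjecture` (ibid.): the rank-zero
`p`-converse `Sel_{p^∞}(E/ℚ) finite ⟹ L(E,1) ≠ 0` at a prime `p ≥ 3` of MULTIPLICATIVE reduction,
under (irr) + (ram), assembled in the kernel from PUBLISHED named facts of the tree — i.e. a kernel
derivation of the second clause of

> C. Skinner, *Multiplicative reduction and the cyclotomic main conjecture for* `GL₂`, Pacific J.
> Math. 283 (2016), 171–200, **Theorem C** (p. 173): "(2) if `L(E,1) = 0` then `Sel_{p^∞}(E)` has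
> `ℤ_p`-corank at least one"

on its multiplicative half (tree: the separate cited-only fact
`Skinner2016.thmC_one_le_selmerCorank_of_L_one_eq_zero`, registry A324, `Or.inr` disjunct of its
hypothesis (a)) from his **Theorem A** (the main conjecture at `p ‖ N`), exactly as the paper
proves it (§3.3: Thm. A + the control / Euler-characteristic formula at a multiplicative prime +
the interpolation property, with Greenberg–Stevens at a split prime). Inputs, all EXISTING named
facts of the tree taken as hypotheses (nothing is restated or minted here):

1. `hA = Skinner2016.thmA_charIdeal_multiplicative` (registry A31; Skinner 2016 Thm. A with §3.2,
   §3.3): `X(E/ℚ_∞)` is `Λ`-torsion, `char_Λ X = (g)`, and `ι(T · g · w) = ϖ · L` at a split `p`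
   (resp. `ι(g · w) = ϖ · L` at a non-split `p`) for THE Mazur–Tate–Teitelbaum `p`-adic
   `L`-function `L` and a unit `w ∈ Λˣ`, `ϖ · Ω_E = Ω⁺_f`;
2. `hGs = Greenberg1999.thm41Analogue_charValue_rankZero_split_baseChange_anyPrime` (A236) and
   `hGn = Greenberg1999.thm41Analogue_charValue_rankZero_numberField_anyPrime` (A235): Greenberg,
   LNM 1716 (1999), §4 pp. 112–113, "the analogue of theorem 4.1" at a split (resp. non-split)
   multiplicative prime — `Sel_{p^∞}(E/ℚ)` finite ⟹
   `g(0) · #E(ℚ)[p^∞]² = u · l_p · p^{ord_p ∏ c_ℓ} · #Sel_{p^∞}(E/ℚ)` with `l_p = 𝓛_p(E)/(2p)`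
   (split) / `l_p = 2` (non-split), `u ∈ ℤ_pˣ`; in particular `g(0) ≠ 0`, the `𝓛`-invariant being
   non-zero by the tree THEOREM `WeierstrassCurve.LInvariant_ne_zero_holds`
   (Barré-Sirieix–Diaz–Gramain–Philibert) and `log_p q_E ≠ 0` by
   `WeierstrassCurve.TateParameterData.padicLog_q_ne_zero … MahlerManinPadic_holds`. THIS is the
   input "(iv) control at a multiplicative `v ∣ p`" of the cell's sizing note
   (`HOME/b2b-bsdres-additive-p1/density-g26/SIZING-h5-mult.md` §2), served by a registered fact
   instead of a new transcription of Greenberg's Prop. 3.7;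
3. `hGS = greenberg_stevens W p` (bsd.S24; Greenberg–Stevens 1993, Kobayashi 2006 Cor. 4.2): at a
   split `p`, `[T¹] L · log_p γ = 𝓛_p(E) · [0]⁺_f` (`log_p γ ≠ 0`:
   `Literature.Barriers.BirchSwinnertonDyer.padicLog_cyclotomicGenerator_ne_zero`);
4. `hmod = nonempty_modularParametrizationData` (BCDT 2001 Thm. A with Edixhoven 1991: the newform
   `f` of `E` and the rational period ratio `ϖ > 0`,
   `ModularParametrizationData.exists_rat_mul_realPeriodRat_eq_plusPeriod`).

The MTT `p`-adic `L`-functions themselves are tree THEOREMS (`exists_isSplitMultPAdicLFunctionOf`,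
`exists_isMultPAdicLFunctionOf_neg_one_of_nonsplit`), as are the cyclotomic data and the Iwasawa
module (`exists_isCyclotomic_isTopGenerator_isCyclotomicVariable_holds`,
`nonempty_selmerDualData_holds`, `SelmerDualData.module_finite_holds`) and the Tate parameter at a
split prime (`nonempty_tateParameterData_iff_holds`).

The chain (`ratPlusSymbol_zero_ne_zero_of_finite_selmerGroupPInfty_of_thmA`): `Sel_{p^∞}(E/ℚ)`
finite ⟹ (2) `g(0) ≠ 0` ⟹ split: `[T¹] ι(T·g·w) = g(0)·w(0) = ϖ·[T¹]L ≠ 0`, so by (3)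
`𝓛_p · [0]⁺_f ≠ 0`; non-split: `g(0)·w(0) = ϖ · L(0) = 2ϖ · [0]⁺_f ≠ 0`
(`IsMultPAdicLFunctionOf.constantCoeff_of_neg_one`, Mazur–Tate–Teitelbaum §I.14 with `α = -1`)
⟹ `[0]⁺_f ≠ 0` ⟹ `L(E,1) = [0]⁺_f · Ω⁺_f ≠ 0` (`IsNewformOf.entireLFunction_one_eq`, `Ω⁺_f > 0`).
Corollaries: the corank forms (`analyticRank_eq_zero_of_selmerCorank_eq_zero_of_thmA`,
`one_le_selmerCorank_of_entireLFunction_one_eq_zero_of_thmA` = Thm. C (2) on its multiplicative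
half), and

> M. Bhargava, C. Skinner, W. Zhang, *A majority of elliptic curves over `ℚ` satisfy the Birch
> and Swinnerton-Dyer conjecture*, arXiv:1407.1826v2, **Theorem 5** (§2.1, p. 5) — "Let `p` be
> an odd prime … (a) `E` has good ordinary or multiplicative reduction at `p`; (b) `E[p]` is an
> irreducible `Gal(ℚ̄/ℚ)`-module; (c) there is at least one prime `ℓ ≠ p` such that `ℓ ‖ N` and
> `E[p]` is ramified at `ℓ`; (d) the `p`-Selmer group `S_p(E)` of `E` is trivial. Then the rank
> and analytic rank of `E` are both equal to `0`", Remark 8: "[Smult]" for the multiplicative case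

on its MULTIPLICATIVE leg (`bsz_thm5_multiplicative_of_thmA`, `…_of_smul_eq`), and the binder
`h5 : ∀ AB, IsInHeightFamily AB → S₀ AB → W AB → #Sel^(5)(E_{A,B}) = 1 → rank = 0 ∧ r_an = 0` of
the theorem of record `bsz_rankLeOne_cRank_of_pieces` (`LeadingTermBSZResCellAssemblyProofs`) in
its own `(A, B)` currency on the MULTIPLICATIVE half of `S₀(5) = {5 ∤ A}`, i.e. `5 ∤ A` and
`5 ∣ 4A³ + 27B²` (Lemma 17 of the source; tree
`hasMultiplicativeReductionAtPrime_shortWeierstrass_iff_of_isInHeightFamily`), once with (ram) read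
on a given global minimal model (`bsz_h5_multiplicative_five_of_thmA_of_smul_eq`, `ℓ ∈ {2,3}`
allowed) and once ENTIRELY in `(A, B)` currency with (ram) in the form of Remark 7
(`bsz_h5_multiplicative_five_of_thmA`). The GOOD-ORDINARY half of `S₀(5)` is the sibling
`bsz_h5_goodOrdinary_five_of_mainConjecture` (additive-p1, below BCS Thm. 1.1.2; not here).

BSD-DENSITY SPRINT (cell `b2b-bsdres`, book `cells/density/CONVERSION-QUEUE.md` §2 Q1, conversion
column "multiplicative leg from A31 + control"): by-name consumer = the D2 glue
`bsz_rankLeOne_cRank_of_facts` (seat `b2b-bsdres-dens-p1`); written as D2-interim by the X2 row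
(`b2b-bsdres-eisenstein-p2`, `p ‖ N` machinery). HONEST FRAMING: kernel glue below NAMED published
inputs; nothing is booked; no density number, RESIDUAL-MAP mark, tier or status word moves by this
file; this is not "finishing BSD".

## References

* [Skinner2016PacificMC] C. Skinner, Pacific J. Math. 283 (2016), 171–200: Thm. A (§1), §3.2,
  §3.3, Thm. C (p. 173) clause (2).
* [GreenbergLNM1716] R. Greenberg, *Iwasawa theory for elliptic curves*, LNM 1716 (1999): §4
  pp. 112–113 ("the analogue of theorem 4.1"), §3 p. 94, §1 pp. 65–66.
* [Kobayashi2006DocMath] S. Kobayashi, Doc. Math. Extra Vol. Coates (2006), Cor. 4.2 (p. 575);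
  [GreenbergStevens1993] R. Greenberg, G. Stevens, Invent. Math. 111 (1993).
* [MazurTateTeitelbaum1986] B. Mazur, J. Tate, J. Teitelbaum, Invent. Math. 84 (1986), §I.14–I.15.
* [BarreSirieixDiazGramainPhilibert1996Manin] K. Barré-Sirieix, G. Diaz, F. Gramain, G. Philibert,
  Invent. Math. 124 (1996), Thm. 1.
* [BhargavaSkinnerZhang2014] M. Bhargava, C. Skinner, W. Zhang, arXiv:1407.1826v2, Thm. 5, Rem. 7,
  Rem. 8 (§2.1, p. 5), Lemma 17 (p. 8).
* [SilvermanAEC2009] J. H. Silverman, GTM 106 (2009), Thm. X.4.2; VIII.8 Cor. 8.3.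
-/

set_option autoImplicit false

noncomputable section

open scoped Classical MatrixGroups ModularForm
open scoped AddSubgroup

open CongruenceSubgroup WeierstrassCurve Literature.NumberTheory.EllipticCurves.ModularForms

namespace Literature.NumberTheory.EllipticCurves

/-! ### The core deduction at `p ‖ N`: `Sel_{p^∞}(E/ℚ)` finite ⟹ `[0]⁺_f ≠ 0` -/

section Core

/-- **Rank-zero `p`-converse at a multiplicative prime, modular-symbol form.** Let `E/ℚ` have
globally minimal model `W`, `p ≥ 3` a prime of MULTIPLICATIVE reduction with `E[p]` irreducible
(irr) and a prime `ℓ ≠ p` of multiplicative reduction with `p ∤ v_ℓ(Δ_min)` (ram), `f` the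
newform of `E` and `ϖ ∈ ℚˣ` with `ϖ · Ω_E = Ω⁺_f`. Granted Skinner's Thm. A (`hA`), Greenberg's
multiplicative Euler-characteristic formulas (`hGs` split / `hGn` non-split) and Greenberg–Stevens
at `(E, p)` (`hGS`): if `Sel_{p^∞}(E/ℚ)` is finite then `[0]⁺_f = L(E,1)/Ω⁺_f ≠ 0`.
Proof (Skinner 2016, §3.3, proof of Thm. C; Greenberg LNM 1716 §1 pp. 65–66): with
`char_Λ X(E/ℚ_∞) = (g)` (Thm. A), finiteness of the Selmer group gives `g(0) ≠ 0` (Greenberg §4,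
`𝓛_p(E) ≠ 0`, `log_p q_E ≠ 0`); at a split `p`, `[T¹] ι(T·g·w) = g(0)·w(0) = ϖ · [T¹]L`, so
`[T¹]L ≠ 0` and `𝓛_p(E)·[0]⁺_f = [T¹]L · log_p γ ≠ 0` (Greenberg–Stevens, `log_p γ ≠ 0`); at a
non-split `p`, `g(0)·w(0) = ϖ · L(0) = 2ϖ · [0]⁺_f ≠ 0` (Mazur–Tate–Teitelbaum §I.14, `α = -1`).
[cite: Skinner2016PacificMC, Thm. A (§1), §3.2, §3.3 and Thm. C (2) (p. 173)]
[cite: GreenbergLNM1716, §4 pp. 112–113 ("the analogue of theorem 4.1") and §1 pp. 65–66]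
[cite: Kobayashi2006DocMath, Cor. 4.2 (p. 575)] [cite: MazurTateTeitelbaum1986, §I.14–I.15] -/
theorem ratPlusSymbol_zero_ne_zero_of_finite_selmerGroupPInfty_of_thmA
    (hA : Skinner2016.thmA_charIdeal_multiplicative)
    (hGs : Greenberg1999.thm41Analogue_charValue_rankZero_split_baseChange_anyPrime)
    (hGn : Greenberg1999.thm41Analogue_charValue_rankZero_numberField_anyPrime)
    (W : WeierstrassCurve ℚ) [W.IsElliptic] [W.IsGloballyMinimal] (p : ℕ) [Fact p.Prime]
    (hGS : greenberg_stevens (W := W) (p := p))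
    (hp : 3 ≤ p) (hmult : W.HasMultiplicativeReductionAtPrime p)
    (hirr : W.HasIrreducibleModPGaloisRep p)
    (hram : ∃ ℓ : ℕ, ∃ _ : Fact ℓ.Prime, ℓ ≠ p ∧ W.HasMultiplicativeReductionAtPrime ℓ ∧
      ¬ p ∣ padicValInt ℓ W.minimalDiscriminantInt)
    {N : ℕ} [NeZero N] {f : CuspForm (Gamma0 N) 2} (hf : IsNewformOf W f)
    (ϖ : ℚ) (hϖ0 : ϖ ≠ 0) (hϖ : (ϖ : ℝ) * W.realPeriodRat = plusPeriod f)
    (hSel : Finite (W.selmerGroupPInfty p)) :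
    ratPlusSymbol f 0 ≠ 0 := by
  have hpP : p.Prime := Fact.out
  -- the cyclotomic `ℤ_p`-extension with a topological generator matching the cyclotomic
  -- variable, and the Iwasawa module `X = X(E/ℚ_∞)` (tree theorems)
  obtain ⟨κ, hκ, γ, hγ, hγ'⟩ := exists_isCyclotomic_isTopGenerator_isCyclotomicVariable_holds p
  obtain ⟨D⟩ := W.nonempty_selmerDualData_holds κ γ hγ
  haveI : Module.Finite (IwasawaAlgebra p) D.X := D.module_finite_holds hγ
  -- (1) Theorem A: `X` torsion, `char X = (g)`, and the two `L`-function clauses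
  obtain ⟨hX, g, hchar, hsp, hnsp⟩ := hA W p hp hmult hirr hram hκ hγ hγ' hf D ϖ hϖ0 hϖ
  haveI := hSel
  have hSel0 : (Nat.card (W.selmerGroupPInfty p) : ℚ_[p]) ≠ 0 := by
    exact_mod_cast Nat.card_pos.ne'
  have hp0 : (p : ℚ_[p]) ≠ 0 := Nat.cast_ne_zero.mpr hpP.ne_zero
  intro hs0
  have hsQ : ((ratPlusSymbol f 0 : ℚ) : ℚ_[p]) = 0 := by rw [hs0, Rat.cast_zero]
  by_cases hsplit : W.HasSplitMultiplicativeReductionAtPrime p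
  · -- SPLIT multiplicative `p`: Tate parameter, THE split `p`-adic `L`-function, `w`
    obtain ⟨Dq⟩ := (nonempty_tateParameterData_iff_holds (W := W) (p := p)).mpr hsplit
    have hlog : padicLog p Dq.q ≠ 0 :=
      WeierstrassCurve.TateParameterData.padicLog_q_ne_zero
        Literature.NumberTheory.Transcendental.MahlerManinPadic_holds Dq
    obtain ⟨L, hL⟩ := exists_isSplitMultPAdicLFunctionOf hsplit hf
    obtain ⟨w, hw⟩ := hsp hsplit L hL
    -- (2) Greenberg §4, split: `g(0) · #E(ℚ)[p^∞]² = u · (𝓛_p/(2p)) · p^{ord ∏ c} · #Sel`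
    obtain ⟨u, hu⟩ := hGs.split_rat W p Dq hlog κ γ hκ hγ D hX g hchar hSel
    have h𝓛 : LInvariant Dq ≠ 0 := (LInvariant_ne_zero_holds (W := W) (p := p)) Dq
    have hg0 : ((PowerSeries.constantCoeff g : ℤ_[p]) : ℚ_[p]) ≠ 0 := by
      intro h0
      rw [h0, zero_mul] at hu
      exact (mul_ne_zero (mul_ne_zero (mul_ne_zero (coe_units_ne_zero p u)
        (div_ne_zero h𝓛 (mul_ne_zero two_ne_zero hp0))) (pow_ne_zero _ hp0)) hSel0) hu.symm
    -- `[T¹] ι(T·g·w) = g(0)·w(0) = ϖ · [T¹]L`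
    have hgw : PowerSeries.constantCoeff (g * (w : IwasawaAlgebra p)) =
        PowerSeries.constantCoeff g * PowerSeries.constantCoeff (w : IwasawaAlgebra p) :=
      map_mul _ _ _
    have h1 : ((PowerSeries.constantCoeff g : ℤ_[p]) : ℚ_[p]) *
        ((PowerSeries.constantCoeff (w : IwasawaAlgebra p) : ℤ_[p]) : ℚ_[p]) =
          ((ϖ : ℚ) : ℚ_[p]) * PowerSeries.coeff 1 L := by
      have h := congrArg (PowerSeries.coeff 1) hw
      rw [show (PowerSeries.X : IwasawaAlgebra p) * g * (w : IwasawaAlgebra p) =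
          PowerSeries.X * (g * (w : IwasawaAlgebra p)) from mul_assoc _ _ _] at h
      rw [iwasawaToPowerSeries, PowerSeries.coeff_map, PowerSeries.coeff_succ_X_mul,
        PowerSeries.coeff_zero_eq_constantCoeff, hgw, PowerSeries.coeff_C_mul, map_mul] at h
      exact h
    -- `w(0)` is a unit of `ℤ_p`
    have hwu : IsUnit (PowerSeries.constantCoeff (w : IwasawaAlgebra p)) :=
      PowerSeries.isUnit_constantCoeff _ w.isUnit
    have hw0 : ((PowerSeries.constantCoeff (w : IwasawaAlgebra p) : ℤ_[p]) : ℚ_[p]) ≠ 0 := by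
      rw [← hwu.unit_spec]
      exact coe_units_ne_zero p hwu.unit
    -- (3) Greenberg–Stevens: `[T¹]L · log_p γ = 𝓛_p · [0]⁺_f = 0`, so `[T¹]L = 0`
    obtain ⟨-, hGS1⟩ := hGS Dq hf hL
    rw [hsQ, mul_zero] at hGS1
    have hcoeff : PowerSeries.coeff 1 L = 0 :=
      (mul_eq_zero.mp hGS1).resolve_right
        (Literature.Barriers.BirchSwinnertonDyer.padicLog_cyclotomicGenerator_ne_zero p)
    rw [hcoeff, mul_zero] at h1
    exact (mul_ne_zero hg0 hw0) h1
  · -- NON-SPLIT multiplicative `p`: THE non-split `p`-adic `L`-function, `w`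
    obtain ⟨L, hL⟩ := exists_isMultPAdicLFunctionOf_neg_one_of_nonsplit hf hmult hsplit
    obtain ⟨w, hw⟩ := hnsp hsplit L hL
    -- (2) Greenberg §4, non-split: `g(0) · #E(ℚ)[p^∞]² = u · p^{ord ∏ c} · 2 · #Sel`
    obtain ⟨u, hu⟩ := hGn.nonsplit_rat W p hmult hsplit κ γ hκ hγ D hX g hchar hSel
    have hg0 : ((PowerSeries.constantCoeff g : ℤ_[p]) : ℚ_[p]) ≠ 0 := by
      intro h0
      rw [h0, zero_mul] at hu
      exact (mul_ne_zero (mul_ne_zero (mul_ne_zero (coe_units_ne_zero p u) (pow_ne_zero _ hp0))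
        two_ne_zero) hSel0) hu.symm
    -- constant coefficients of `ι(g · w) = ϖ · L`: `g(0) · w(0) = ϖ · L(0) = 2ϖ · [0]⁺_f = 0`
    have hL0 : PowerSeries.constantCoeff L = 2 * (ratPlusSymbol f 0 : ℚ_[p]) :=
      hL.constantCoeff_of_neg_one
    have hgw : PowerSeries.constantCoeff (g * (w : IwasawaAlgebra p)) =
        PowerSeries.constantCoeff g * PowerSeries.constantCoeff (w : IwasawaAlgebra p) :=
      map_mul _ _ _
    have h0 := congrArg PowerSeries.constantCoeff hw
    rw [constantCoeff_iwasawaToPowerSeries, hgw, PadicInt.coe_mul, map_mul,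
      PowerSeries.constantCoeff_C, hL0, hsQ, mul_zero, mul_zero] at h0
    have hwu : IsUnit (PowerSeries.constantCoeff (w : IwasawaAlgebra p)) :=
      PowerSeries.isUnit_constantCoeff _ w.isUnit
    have hw0 : ((PowerSeries.constantCoeff (w : IwasawaAlgebra p) : ℤ_[p]) : ℚ_[p]) ≠ 0 := by
      rw [← hwu.unit_spec]
      exact coe_units_ne_zero p hwu.unit
    exact (mul_ne_zero hg0 hw0) h0

/-- **Rank-zero `p`-converse at a multiplicative prime, `L`-value form.** Let `E/ℚ` have globally
minimal model `W`, `p ≥ 3` a prime of multiplicative reduction, `E[p]` irreducible, and (ram): a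
prime `ℓ ≠ p` of multiplicative reduction with `p ∤ v_ℓ(Δ_min)`. Granted modularity with the
period ratio (`hmod`: the newform `f` and `ϖ > 0` with `ϖ · Ω_E = Ω⁺_f`), Skinner's Thm. A (`hA`),
Greenberg's multiplicative Euler-characteristic formulas (`hGs`, `hGn`) and Greenberg–Stevens at
`(E, p)` (`hGS`): if `Sel_{p^∞}(E/ℚ)` is finite then `L(E,1) ≠ 0` — `L(E,1) = [0]⁺_f · Ω⁺_f` with
`Ω⁺_f > 0` and `[0]⁺_f ≠ 0` by `ratPlusSymbol_zero_ne_zero_of_finite_selmerGroupPInfty_of_thmA`.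
This is the contrapositive of Skinner 2016 Thm. C (2) at a multiplicative `p`, DERIVED from Thm. A
as in the paper's §3.3. [cite: Skinner2016PacificMC, Thm. A (§1), §3.3 and Thm. C (2) (p. 173)]
[cite: GreenbergLNM1716, §4 pp. 112–113 and §1 pp. 65–66] -/
theorem entireLFunction_one_ne_zero_of_finite_selmerGroupPInfty_of_thmA
    (hmod : nonempty_modularParametrizationData)
    (hA : Skinner2016.thmA_charIdeal_multiplicative)
    (hGs : Greenberg1999.thm41Analogue_charValue_rankZero_split_baseChange_anyPrime)
    (hGn : Greenberg1999.thm41Analogue_charValue_rankZero_numberField_anyPrime)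
    (W : WeierstrassCurve ℚ) [W.IsElliptic] [W.IsGloballyMinimal] (p : ℕ) [Fact p.Prime]
    (hGS : greenberg_stevens (W := W) (p := p))
    (hp : 3 ≤ p) (hmult : W.HasMultiplicativeReductionAtPrime p)
    (hirr : W.HasIrreducibleModPGaloisRep p)
    (hram : ∃ ℓ : ℕ, ∃ _ : Fact ℓ.Prime, ℓ ≠ p ∧ W.HasMultiplicativeReductionAtPrime ℓ ∧
      ¬ p ∣ padicValInt ℓ W.minimalDiscriminantInt)
    (hSel : Finite (W.selmerGroupPInfty p)) :
    W.entireLFunction 1 ≠ 0 := by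
  -- modularity: the newform `f` of `E` and the period ratio `ϖ > 0`
  haveI : NeZero (W.conductorNorm ℤ) := ⟨(W.conductorNorm_pos_holds).ne'⟩
  obtain ⟨Dm⟩ := hmod W
  obtain ⟨ϖ, hϖpos, hϖ, -⟩ := Dm.exists_rat_mul_realPeriodRat_eq_plusPeriod
  have hf : IsNewformOf W Dm.f := Dm.isNewformOf
  have hs : ratPlusSymbol Dm.f 0 ≠ 0 :=
    ratPlusSymbol_zero_ne_zero_of_finite_selmerGroupPInfty_of_thmA hA hGs hGn W p hGS hp hmult hirr
      hram hf ϖ hϖpos.ne' hϖ hSel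
  -- `L(E, 1) = [0]⁺_f · Ω⁺_f` with `Ω⁺_f > 0`
  have hpos : 0 < plusPeriod Dm.f := IsNewform0.plusPeriod_pos_holds hf.1 hf.coeffField_eq_bot
  rw [hf.entireLFunction_one_eq, Complex.ofReal_ne_zero]
  exact mul_ne_zero (by exact_mod_cast hs) hpos.ne'

end Core

/-! ### Corank forms: Skinner 2016 Thm. C (2) on its multiplicative half, derived -/

section Corank

/-- **Rank-zero `p`-converse at a multiplicative prime `p ≥ 3`** under (irr) + (ram), below
modularity, Skinner's Thm. A, Greenberg's §4 formulas and Greenberg–Stevens at `(E, p)`: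
`corank_{ℤ_p} Sel_{p^∞}(E/ℚ) = 0 ⟹ ord_{s=1} L(E, s) = 0`. Corank `0` means `Sel_{p^∞}(E/ℚ)`
finite (`finite_selmerGroupPInfty_iff_selmerCorank_eq_zero`), and `L(E,1) ≠ 0` gives order `0`
(`analyticRank_eq_zero_of_entireLFunction_one_ne_zero`). The multiplicative companion of
`analyticRank_eq_zero_of_selmerCorank_eq_zero_of_mainConjecture` (good ordinary, BCS route).
[cite: Skinner2016PacificMC, Thm. A (§1), §3.3 and Thm. C (2) (p. 173)]
[cite: GreenbergLNM1716, §1 pp. 65–66] -/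
theorem analyticRank_eq_zero_of_selmerCorank_eq_zero_of_thmA
    (hmod : nonempty_modularParametrizationData)
    (hA : Skinner2016.thmA_charIdeal_multiplicative)
    (hGs : Greenberg1999.thm41Analogue_charValue_rankZero_split_baseChange_anyPrime)
    (hGn : Greenberg1999.thm41Analogue_charValue_rankZero_numberField_anyPrime)
    (W : WeierstrassCurve ℚ) [W.IsElliptic] [W.IsGloballyMinimal] (p : ℕ) [Fact p.Prime]
    (hGS : greenberg_stevens (W := W) (p := p))
    (hp : 3 ≤ p) (hmult : W.HasMultiplicativeReductionAtPrime p)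
    (hirr : W.HasIrreducibleModPGaloisRep p)
    (hram : ∃ ℓ : ℕ, ∃ _ : Fact ℓ.Prime, ℓ ≠ p ∧ W.HasMultiplicativeReductionAtPrime ℓ ∧
      ¬ p ∣ padicValInt ℓ W.minimalDiscriminantInt)
    (h0 : W.selmerCorank p = 0) :
    W.analyticRank = 0 :=
  analyticRank_eq_zero_of_entireLFunction_one_ne_zero W
    (entireLFunction_one_ne_zero_of_finite_selmerGroupPInfty_of_thmA hmod hA hGs hGn W p hGS hp
      hmult hirr hram ((finite_selmerGroupPInfty_iff_selmerCorank_eq_zero W p).2 h0))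

/-- **Skinner 2016 Thm. C, clause (2), at a MULTIPLICATIVE prime — derived from Thm. A:
`L(E, 1) = 0 ⟹ corank_{ℤ_p} Sel_{p^∞}(E/ℚ) ≥ 1`** for `p ≥ 3` of multiplicative reduction under
(irr) + (ram), below modularity, Thm. A, Greenberg's §4 formulas and Greenberg–Stevens at
`(E, p)`. As printed (Pacific J. Math. 283 (2016), Thm. C, p. 173): "(2) if `L(E,1) = 0` then
`Sel_{p^∞}(E)` has `ℤ_p`-corank at least one" — here the `Or.inr` (multiplicative) disjunct of
hypothesis (a) of the tree's cited-only transcription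
`Skinner2016.thmC_one_le_selmerCorank_of_L_one_eq_zero`, in the same binder currency.
[cite: Skinner2016PacificMC, Thm. C (2) (p. 173), Thm. A (§1) and §3.3] -/
theorem one_le_selmerCorank_of_entireLFunction_one_eq_zero_of_thmA
    (hmod : nonempty_modularParametrizationData)
    (hA : Skinner2016.thmA_charIdeal_multiplicative)
    (hGs : Greenberg1999.thm41Analogue_charValue_rankZero_split_baseChange_anyPrime)
    (hGn : Greenberg1999.thm41Analogue_charValue_rankZero_numberField_anyPrime)
    (W : WeierstrassCurve ℚ) [W.IsElliptic] [W.IsGloballyMinimal] (p : ℕ) [Fact p.Prime]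
    (hGS : greenberg_stevens (W := W) (p := p))
    (hp : 3 ≤ p) (hmult : W.HasMultiplicativeReductionAtPrime p)
    (hirr : W.HasIrreducibleModPGaloisRep p)
    (hram : ∃ ℓ : ℕ, ∃ _ : Fact ℓ.Prime, ℓ ≠ p ∧ W.HasMultiplicativeReductionAtPrime ℓ ∧
      ¬ p ∣ padicValInt ℓ W.minimalDiscriminantInt)
    (hL : W.entireLFunction 1 = 0) :
    1 ≤ W.selmerCorank p := by
  by_contra h
  have h0 : W.selmerCorank p = 0 := by omega
  exact entireLFunction_one_ne_zero_of_finite_selmerGroupPInfty_of_thmA hmod hA hGs hGn W p hGS hp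
    hmult hirr hram ((finite_selmerGroupPInfty_iff_selmerCorank_eq_zero W p).2 h0) hL

end Corank

/-! ### Hypothesis (d) "`S_p(E)` trivial" in the tree's currencies (fact-free descent bookkeeping)

Private twins of the fact-free lemmas of `SelmerTrivialCorankProofs` (additive-p1, p369097), kept
local so that this file's import closure avoids that module while its farm build is incoherent with
the tree text (rename of 2026-08-23); same three-line proofs, same sources. -/

section Descent

/-- `#Sel^(p)(E/ℚ) = 1` forces `rank E(ℚ) = 0` and `Ш(E/ℚ) ⊓ H¹(ℚ, E)[p] = 0`: the exact descent
count `#Sel^(p) = p^{rank} · #E(ℚ)[p] · #(Ш ⊓ H¹[p])` (Silverman, *AEC* X.4.2; tree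
`natCard_selmerGroup_eq`) has all factors `1`. [cite: SilvermanAEC2009, Thm X.4.2] -/
private theorem rank_eq_zero_and_sha_inf_torsionBy_eq_bot_of_card (E : WeierstrassCurve ℚ)
    [E.IsElliptic] (p : ℕ) [Fact p.Prime] (h : Nat.card (E.selmerGroup p) = 1) :
    E.mordellWeilRank = 0 ∧
      (E.sha ⊓ AddSubgroup.torsionBy E.galH1 (p : ℤ) : AddSubgroup E.galH1) = ⊥ := by
  have hp : p.Prime := Fact.out
  have hcard := E.natCard_selmerGroup_eq hp.ne_zero
  rw [h] at hcard
  have h12 := Nat.eq_one_of_mul_eq_one_right hcard.symm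
  have h3 := Nat.eq_one_of_mul_eq_one_left hcard.symm
  have h1 := Nat.eq_one_of_mul_eq_one_right h12
  refine ⟨?_, AddSubgroup.eq_bot_of_card_eq _ h3⟩
  rcases Nat.pow_eq_one.mp h1 with h | h
  · exact absurd h hp.one_lt.ne'
  · exact h

/-- In rank `0` with `Ш(E/ℚ) ⊓ H¹(ℚ, E)[p] = 0`, `Sel_{p^∞}(E/ℚ)` is finite (indeed trivial):
`E(ℚ)` is finite (Mordell–Weil), `#Sel_{p^∞}(E/ℚ) = #Ш(E/ℚ)[p^∞]` (Greenberg, LNM 1716, §1 p. 54;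
tree `natCard_selmerGroupPInfty_eq_natCard_primaryComponent_sha`) and `Ш[p^∞] = 0`
(`primaryComponent_sha_eq_bot_of_inf_torsionBy_eq_bot`). [cite: GreenbergLNM1716, §1 p. 54]
[cite: SilvermanAEC2009, Thm X.4.2] -/
private theorem finite_selmerGroupPInfty_of_rank_eq_zero_of_sha (E : WeierstrassCurve ℚ)
    [E.IsElliptic] (p : ℕ) [Fact p.Prime] (hr : E.mordellWeilRank = 0)
    (hsha : (E.sha ⊓ AddSubgroup.torsionBy E.galH1 (p : ℤ) : AddSubgroup E.galH1) = ⊥) :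
    Finite (E.selmerGroupPInfty p) := by
  haveI : Finite E.toAffine.Point := E.mordellWeilRank_eq_zero_iff_finite.mp hr
  have hbot := primaryComponent_sha_eq_bot_of_inf_torsionBy_eq_bot E p hsha
  have hcard := E.natCard_selmerGroupPInfty_eq_natCard_primaryComponent_sha p
  rw [hbot, AddSubgroup.card_bot] at hcard
  exact Nat.finite_of_card_ne_zero (by omega)

/-- `Ш(C • W) ⊓ H¹[p] = 0 ⟹ Ш(W) ⊓ H¹[p] = 0` for an admissible change of variables `C`: `Ш` is
attached to `E/ℚ`, not to an equation (Silverman, *AEC* X.§4) — the tree's additive isomorphism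
`galH1Equiv W C : H¹(ℚ, W) ≃+ H¹(ℚ, C • W)` identifies the two Tate–Shafarevich groups
(`mem_sha_iff_galH1Equiv_mem`) and commutes with multiplication by `p`. [cite: SilvermanAEC2009, X.§4] -/
private theorem sha_inf_torsionBy_eq_bot_of_smul (W : WeierstrassCurve ℚ) (C : VariableChange ℚ)
    (p : ℕ)
    (h : ((C • W).sha ⊓ AddSubgroup.torsionBy (C • W).galH1 (p : ℤ) :
      AddSubgroup (C • W).galH1) = ⊥) :
    (W.sha ⊓ AddSubgroup.torsionBy W.galH1 (p : ℤ) : AddSubgroup W.galH1) = ⊥ := by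
  rw [eq_bot_iff]
  intro c hc
  obtain ⟨hsha, htor⟩ := AddSubgroup.mem_inf.mp hc
  have hc' : galH1Equiv W C c ∈
      ((C • W).sha ⊓ AddSubgroup.torsionBy (C • W).galH1 (p : ℤ) : AddSubgroup (C • W).galH1) := by
    refine AddSubgroup.mem_inf.mpr ⟨(mem_sha_iff_galH1Equiv_mem W C c).1 hsha, ?_⟩
    have hn := AddSubgroup.torsionBy.nsmul_iff.mp htor
    refine AddSubgroup.torsionBy.nsmul_iff.mpr ?_
    rw [← map_nsmul, hn, map_zero]
  rw [h, AddSubgroup.mem_bot, map_eq_zero_iff _ (galH1Equiv W C).injective] at hc'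
  rw [AddSubgroup.mem_bot, hc']

end Descent

/-! ### Bhargava–Skinner–Zhang Thm. 5, multiplicative leg, below Thm. A -/

section ThmFive

/-- **Bhargava–Skinner–Zhang Thm. 5, MULTIPLICATIVE LEG at `p ≥ 3`, below the main conjecture.**
Let `E/ℚ` have globally minimal model `W`, `p ≥ 3` a prime of multiplicative reduction (printed
(a), second alternative) with `E[p]` irreducible (printed (b)), a prime `ℓ ≠ p` of multiplicative
reduction with `p ∤ v_ℓ(Δ_min)` (printed (c), Tate form), and suppose `#Sel^(p)(E/ℚ) = 1` (printed
(d)). Then `rank E(ℚ) = 0` and `ord_{s=1} L(E,s) = 0` — the rank fact-free (exact descent count,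
Silverman X.4.2), the analytic rank below modularity (`hmod`), Skinner 2016 Thm. A (`hA`),
Greenberg's §4 formulas (`hGs`, `hGn`) and Greenberg–Stevens at `(E, p)` (`hGS`): `#Sel^(p) = 1`
gives rank `0` and `Ш ⊓ H¹[p] = 0`, so `Sel_{p^∞}(E/ℚ) ≅ Ш[p^∞] = 0` is finite (fact-free; the
first sentence of the printed proof of Thm. 5: "If the `p`-Selmer group `S_p(E)` of `E` is trivial,
then so is the `p^∞`-Selmer group"), and
`entireLFunction_one_ne_zero_of_finite_selmerGroupPInfty_of_thmA` applies. Printed source of the deduction: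
Rem. 8 ("[Smult] … consequences of the Iwasawa–Greenberg main conjecture"). This is the `Or.inr`
disjunct of the cited-only fact `BhargavaSkinnerZhang2014.thm5_rank_zero_of_pSelmer_trivial`
(registry A323) in the same binder currency, derived.
[cite: BhargavaSkinnerZhang2014, Thm. 5 and Rem. 8 (§2.1, p. 5)]
[cite: Skinner2016PacificMC, Thm. A (§1), §3.3 and Thm. C (2) (p. 173)] -/
theorem bsz_thm5_multiplicative_of_thmA
    (hmod : nonempty_modularParametrizationData)
    (hA : Skinner2016.thmA_charIdeal_multiplicative)
    (hGs : Greenberg1999.thm41Analogue_charValue_rankZero_split_baseChange_anyPrime)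
    (hGn : Greenberg1999.thm41Analogue_charValue_rankZero_numberField_anyPrime)
    (W : WeierstrassCurve ℚ) [W.IsElliptic] [W.IsGloballyMinimal] (p : ℕ) [Fact p.Prime]
    (hGS : greenberg_stevens (W := W) (p := p))
    (hp : 3 ≤ p) (hmult : W.HasMultiplicativeReductionAtPrime p)
    (hirr : W.HasIrreducibleModPGaloisRep p)
    (hram : ∃ ℓ : ℕ, ∃ _ : Fact ℓ.Prime, ℓ ≠ p ∧ W.HasMultiplicativeReductionAtPrime ℓ ∧
      ¬ p ∣ padicValInt ℓ W.minimalDiscriminantInt)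
    (hSel : Nat.card (W.selmerGroup p) = 1) :
    W.mordellWeilRank = 0 ∧ W.analyticRank = 0 :=
  have hd := rank_eq_zero_and_sha_inf_torsionBy_eq_bot_of_card W p hSel
  ⟨hd.1, analyticRank_eq_zero_of_entireLFunction_one_ne_zero W
    (entireLFunction_one_ne_zero_of_finite_selmerGroupPInfty_of_thmA hmod hA hGs hGn W p hGS hp
      hmult hirr hram (finite_selmerGroupPInfty_of_rank_eq_zero_of_sha W p hd.1 hd.2))⟩

/-- **Thm. 5, multiplicative leg, for an ARBITRARY model.** Let `E/ℚ` be an elliptic curve (any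
Weierstrass equation) and `W` a global minimal model of it, `C • W = E`; suppose `p ≥ 3`, `W` has
multiplicative reduction at `p`, (ram) holds on `W` (it mentions `Δ_min`), `E[p]` is irreducible
and `#Sel^(p)(E/ℚ) = 1` (read on `E`: isomorphism invariants), and Greenberg–Stevens holds at
`(W, p)`. Then `rank E(ℚ) = 0 ∧ ord_{s=1} L(E,s) = 0`, below `hmod`, `hA`, `hGs`, `hGn`
(transport along `C`: `hasIrreducibleModPGaloisRep_smul_iff`, `mordellWeilRank_variableChange_holds`,
`Ш ⊓ H¹[p]` through `galH1Equiv`, `analyticRank_smul` — rank, `Ш`, `E[p]` and `L(E, s)` are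
attached to `E/ℚ`, not to an equation, Silverman X.§4).
[cite: BhargavaSkinnerZhang2014, Thm. 5 (§2.1, p. 5)] [cite: SilvermanAEC2009, X.§4 and VIII.8 Cor. 8.3] -/
theorem bsz_thm5_multiplicative_of_thmA_of_smul_eq
    (hmod : nonempty_modularParametrizationData)
    (hA : Skinner2016.thmA_charIdeal_multiplicative)
    (hGs : Greenberg1999.thm41Analogue_charValue_rankZero_split_baseChange_anyPrime)
    (hGn : Greenberg1999.thm41Analogue_charValue_rankZero_numberField_anyPrime)
    {W : WeierstrassCurve ℚ} [W.IsElliptic] [W.IsGloballyMinimal] {C : VariableChange ℚ}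
    {E : WeierstrassCurve ℚ} [E.IsElliptic] (hCW : C • W = E) (p : ℕ) [Fact p.Prime]
    (hGS : greenberg_stevens (W := W) (p := p))
    (hp : 3 ≤ p) (hmult : W.HasMultiplicativeReductionAtPrime p)
    (hirr : E.HasIrreducibleModPGaloisRep p)
    (hram : ∃ ℓ : ℕ, ∃ _ : Fact ℓ.Prime, ℓ ≠ p ∧ W.HasMultiplicativeReductionAtPrime ℓ ∧
      ¬ p ∣ padicValInt ℓ W.minimalDiscriminantInt)
    (hSel : Nat.card (E.selmerGroup p) = 1) :
    E.mordellWeilRank = 0 ∧ E.analyticRank = 0 := by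
  subst hCW
  -- descent on `E = C • W`, transported to `W`
  obtain ⟨hrE, hshaE⟩ := rank_eq_zero_and_sha_inf_torsionBy_eq_bot_of_card (C • W) p hSel
  have hrW : W.mordellWeilRank = 0 := by
    rw [← mordellWeilRank_variableChange_holds W C]; exact hrE
  have hfinW : Finite (W.selmerGroupPInfty p) :=
    finite_selmerGroupPInfty_of_rank_eq_zero_of_sha W p hrW
      (sha_inf_torsionBy_eq_bot_of_smul W C p hshaE)
  have hirrW : W.HasIrreducibleModPGaloisRep p :=
    (Mazur1978.hasIrreducibleModPGaloisRep_smul_iff W C p).1 hirr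
  refine ⟨hrE, ?_⟩
  rw [analyticRank_smul]
  exact analyticRank_eq_zero_of_entireLFunction_one_ne_zero W
    (entireLFunction_one_ne_zero_of_finite_selmerGroupPInfty_of_thmA hmod hA hGs hGn W p hGS hp
      hmult hirrW hram hfinW)

end ThmFive

/-! ### The binder `h5` in `(A, B)` currency on the MULTIPLICATIVE half of `S₀(5)` -/

section HeightFamily

/-- **The binder `h5` of `bsz_rankLeOne_cRank_of_pieces` on the MULTIPLICATIVE half of
`S₀(5) = {5 ∤ A}`, below the main conjecture, (ram) read on a given global minimal model.** For
`(A, B)` in the height family and a global minimal model `W` of `E_{A,B}` (`C • W = E_{A,B}`): if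
`5 ∤ A` and `5 ∣ 4A³ + 27B²` — i.e. `E_{A,B}` has MULTIPLICATIVE reduction at `5` (Lemma 17 of the
source; tree `hasMultiplicativeReductionAtPrime_shortWeierstrass_iff_of_isInHeightFamily`) —,
`E_{A,B}[5]` is irreducible (printed (b)), some prime `ℓ ≠ 5` of multiplicative reduction of `W`
has `5 ∤ v_ℓ(Δ_min)` (printed (c), Tate form; `ℓ ∈ {2, 3}` allowed), and `#Sel^(5)(E_{A,B}/ℚ) = 1`
(printed (d)), then `rank E_{A,B}(ℚ) = 0 ∧ ord_{s=1} L(E_{A,B}, s) = 0` — granted modularity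
(`hmod`), Skinner 2016 Thm. A (`hA`), Greenberg's §4 formulas (`hGs`, `hGn`) and Greenberg–Stevens
at `5` for every `E/ℚ` (`hGS`). [cite: BhargavaSkinnerZhang2014, Thm. 5 (§2.1, p. 5) and Lemma 17 (p. 8)]
[cite: Skinner2016PacificMC, Thm. A (§1), §3.3 and Thm. C (2) (p. 173)] -/
theorem bsz_h5_multiplicative_five_of_thmA_of_smul_eq
    (hmod : nonempty_modularParametrizationData)
    (hA : Skinner2016.thmA_charIdeal_multiplicative)
    (hGs : Greenberg1999.thm41Analogue_charValue_rankZero_split_baseChange_anyPrime)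
    (hGn : Greenberg1999.thm41Analogue_charValue_rankZero_numberField_anyPrime)
    [Fact (Nat.Prime 5)]
    (hGS : ∀ (V : WeierstrassCurve ℚ) [V.IsElliptic] [V.IsGloballyMinimal],
      greenberg_stevens (W := V) (p := 5))
    {W : WeierstrassCurve ℚ} [W.IsElliptic] [W.IsGloballyMinimal] {C : VariableChange ℚ}
    {AB : ℤ × ℤ} (hfam : IsInHeightFamily AB) (hCW : C • W = shortWeierstrass AB)
    (hA5 : ¬ (5 : ℤ) ∣ AB.1) (hD : (5 : ℤ) ∣ 4 * AB.1 ^ 3 + 27 * AB.2 ^ 2)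
    (hirr : (shortWeierstrass AB).HasIrreducibleModPGaloisRep 5)
    (hram : ∃ ℓ : ℕ, ∃ _ : Fact ℓ.Prime, ℓ ≠ 5 ∧ W.HasMultiplicativeReductionAtPrime ℓ ∧
      ¬ 5 ∣ padicValInt ℓ W.minimalDiscriminantInt)
    (hSel : Nat.card ((shortWeierstrass AB).selmerGroup 5) = 1) :
    (shortWeierstrass AB).mordellWeilRank = 0 ∧ (shortWeierstrass AB).analyticRank = 0 := by
  haveI := isElliptic_shortWeierstrass hfam
  -- (a), multiplicative alternative, on `E_{A,B}` and on `W`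
  have hmultE : (shortWeierstrass AB).HasMultiplicativeReductionAtPrime 5 :=
    (hasMultiplicativeReductionAtPrime_shortWeierstrass_iff_of_isInHeightFamily 5 hfam le_rfl).2
      ⟨by exact_mod_cast hD, by exact_mod_cast hA5⟩
  have hmult : W.HasMultiplicativeReductionAtPrime 5 := by
    rw [← hasMultiplicativeReductionAtPrime_smul_iff W C 5, hCW]; exact hmultE
  exact bsz_thm5_multiplicative_of_thmA_of_smul_eq hmod hA hGs hGn hCW 5 (hGS W) (by norm_num)
    hmult hirr (by exact_mod_cast hram) (by exact_mod_cast hSel)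

/-- **The binder `h5` of `bsz_rankLeOne_cRank_of_pieces` on the MULTIPLICATIVE half of
`S₀(5) = {5 ∤ A}`, ENTIRELY IN THE `(A, B)` CURRENCY of the height family, below the main
conjecture.** Hypotheses on `(A, B) ∈` the family: `5 ∤ A` and `5 ∣ 4A³ + 27B²` (`E_{A,B}`
multiplicative at `5`, Lemma 17); `E_{A,B}[5]` irreducible (printed (b)); printed (c) in the form
of Remark 7 of the source — "for `ℓ ≥ 5`, a Weierstrass equation `E_{A,B}` … is minimal at `ℓ`,
and so if `ℓ ‖ N` then `E_{A,B}[p]` is ramified at `ℓ` if and only if `p ∤ ord_ℓ(Δ(E_{A,B}))`":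
some prime `ℓ > 5` of multiplicative reduction of `E_{A,B}` (for `ℓ ≥ 5` this is
`ℓ ∣ 4A³ + 27B² ∧ ℓ ∤ A`, tree `hasMultiplicativeReductionAtPrime_shortWeierstrass_iff_of_isInHeightFamily`)
with `5 ∤ ord_ℓ(4A³ + 27B²)` (tree `padicValInt_minimalDiscriminantInt_smul_shortWeierstrass`:
`v_ℓ(Δ_min) = ord_ℓ(4A³ + 27B²)` for `ℓ ≥ 5`); and `#Sel^(5)(E_{A,B}/ℚ) = 1` (printed (d)).
Conclusion: `rank E_{A,B}(ℚ) = 0 ∧ ord_{s=1} L(E_{A,B}, s) = 0`, granted `hmod`, `hA`, `hGs`,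
`hGn` and Greenberg–Stevens at `5` for every `E/ℚ` (`hGS`). A global minimal model is taken inside
(`hasGlobalMinimalModel_rat_holds`, Silverman VIII.8 Cor. 8.3). (Primes `ℓ ∈ {2, 3}` in (c) are
not covered by this form; use `bsz_h5_multiplicative_five_of_thmA_of_smul_eq`.) The GOOD-ORDINARY
half of `S₀(5)` (`5 ∤ 4A³ + 27B²`) is the sibling `bsz_h5_goodOrdinary_five_of_mainConjecture`.
[cite: BhargavaSkinnerZhang2014, Thm. 5, Rem. 7 (§2.1, p. 5) and Lemma 17 (p. 8)]
[cite: Skinner2016PacificMC, Thm. A (§1), §3.3 and Thm. C (2) (p. 173)]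
[cite: SilvermanAEC2009, VIII.8 Cor. 8.3] -/
theorem bsz_h5_multiplicative_five_of_thmA
    (hmod : nonempty_modularParametrizationData)
    (hA : Skinner2016.thmA_charIdeal_multiplicative)
    (hGs : Greenberg1999.thm41Analogue_charValue_rankZero_split_baseChange_anyPrime)
    (hGn : Greenberg1999.thm41Analogue_charValue_rankZero_numberField_anyPrime)
    [Fact (Nat.Prime 5)]
    (hGS : ∀ (V : WeierstrassCurve ℚ) [V.IsElliptic] [V.IsGloballyMinimal],
      greenberg_stevens (W := V) (p := 5))
    {AB : ℤ × ℤ} (hfam : IsInHeightFamily AB) (hA5 : ¬ (5 : ℤ) ∣ AB.1)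
    (hD : (5 : ℤ) ∣ 4 * AB.1 ^ 3 + 27 * AB.2 ^ 2)
    (hirr : (shortWeierstrass AB).HasIrreducibleModPGaloisRep 5)
    (hram : ∃ ℓ : ℕ, ∃ _ : Fact ℓ.Prime, 5 < ℓ ∧
      (shortWeierstrass AB).HasMultiplicativeReductionAtPrime ℓ ∧
      ¬ 5 ∣ padicValInt ℓ (4 * AB.1 ^ 3 + 27 * AB.2 ^ 2))
    (hSel : Nat.card ((shortWeierstrass AB).selmerGroup 5) = 1) :
    (shortWeierstrass AB).mordellWeilRank = 0 ∧ (shortWeierstrass AB).analyticRank = 0 := by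
  haveI := isElliptic_shortWeierstrass hfam
  obtain ⟨C, hC⟩ := hasGlobalMinimalModel_rat_holds (shortWeierstrass AB)
  have hCW : C⁻¹ • (C • shortWeierstrass AB) = shortWeierstrass AB := by
    rw [smul_smul, inv_mul_cancel, one_smul]
  obtain ⟨ℓ, hℓ, h5ℓ, hmult, hval⟩ := hram
  have hramW : ∃ ℓ : ℕ, ∃ _ : Fact ℓ.Prime, ℓ ≠ 5 ∧
      (C • shortWeierstrass AB).HasMultiplicativeReductionAtPrime ℓ ∧
      ¬ 5 ∣ padicValInt ℓ (C • shortWeierstrass AB).minimalDiscriminantInt := by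
    refine ⟨ℓ, hℓ, by omega, (hasMultiplicativeReductionAtPrime_smul_iff _ C ℓ).2 hmult, ?_⟩
    rwa [padicValInt_minimalDiscriminantInt_smul_shortWeierstrass hfam (C • shortWeierstrass AB) C
      rfl (by omega)]
  exact bsz_h5_multiplicative_five_of_thmA_of_smul_eq hmod hA hGs hGn hGS hfam hCW hA5 hD hirr hramW
    hSel

end HeightFamily

end Literature.NumberTheory.EllipticCurves

end
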